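import Summits.ResolutionOfSingularities.ResolutionOfSingularities.Theorems.EquisingularLiftEquisingularLiftNatLargeCharSpreadCentres
import Summits.ResolutionOfSingularities.ResolutionOfSingularities.Theorems.EquisingularLiftEquisingularLiftNatDescWordBaseChange
import Summits.ResolutionOfSingularities.ResolutionOfSingularities.Theorems.EquisingularLiftEquisingularLiftNatLargeCharFibreTokens
import Summits.ResolutionOfSingularities.ResolutionOfSingularities.Theorems.EquisingularLiftEquisingularLiftNatLargeCharFibreStrictTransformSat
import Summits.ResolutionOfSingularities.ResolutionOfSingularities.Theorems.EquisingularLiftEquisingularLiftNatLargeCharSpreadFlat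
import Summits.ResolutionOfSingularities.ResolutionOfSingularities.Theorems.EquisingularLiftEquisingularLiftNatLargeCharSpreadInclusion
import Summits.ResolutionOfSingularities.ResolutionOfSingularities.Theorems.EquisingularLiftEquisingularLiftNatLargeCharGenericThread
import Summits.ResolutionOfSingularities.ResolutionOfSingularities.Theorems.EquisingularLiftEquisingularLiftNatLargeCharPositionToken
import Summits.ResolutionOfSingularities.ResolutionOfSingularities.Theorems.EquisingularLiftEquisingularLiftNatLargeCharSpreadNoSwallow
import Summits.ResolutionOfSingularities.ResolutionOfSingularities.Theorems.EquisingularLiftEquisingularLiftNatLargeCharSpreadFibreWord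
import Summits.ResolutionOfSingularities.ResolutionOfSingularities.Theorems.EquisingularLiftEquisingularLiftNatNoseSectionStepTools
import Literature.AlgebraicGeometry.Resolution.MarkedIdealsEtale
import Literature.AlgebraicGeometry.Resolution.SmoothOfRegularPerfectField
import Literature.AlgebraicGeometry.Resolution.StrictTransformSupport
import Mathlib.FieldTheory.Perfect
import HarnessLib

/-!
# EL♮(3) / EL♮(n), RUNG LC «large characteristic» — brick (B5)+(f3): THE FULL FIBRE WORD — `DescTransformOK` with its TRUE position target on every
# fibre over every base `A → B` inverting some `a ≠ 0`, from the K-side word of an integral running transform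

leafhand-res-equisingularlift-3 g0 (prover, 2026-08-31; one-generation line-first hand on stmt-ResolutionOfSingularities-20148 / -20038 /
-15660, cell `pub/decomp-res`).  Crux `EquisingularLiftNatThree` (`stmt-…-20148`; uniform in `n`, so also `stmt-…-20038`), line W4.5(b), RUNG LC
(idea-2 g32 `Cruxes/EquisingularLiftNatThree/LARGE-CHAR-RUNG-idea2.md` v1.6 §(B3′) (f1)–(f4), §(B5′)).  Sequel of ✓ `CentreSeq.exists_forall_descTransformOK_comap`
(…NatLargeCharSpreadFibreWord, position target emptied): the position token is now GENUINE, threaded by the generic-point invariant INV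
(✓ `image_support_subset_not_isGenericPoint_of_inv`, ✓ `inv_closure_preimage_diff_of_isBlowup`, …NatLargeCharPositionToken) whose per-stage input
«the centre fibre does not swallow the running-transform fibre» SPREADS by Chevalley (✓ `exists_forall_not_support_comap_subset`, …NatLargeCharSpreadNoSwallow —
no dimension theory).  DEF-FREE:

* ★★★ `CentreSeq.exists_forall_descTransformOK_comap_of_inv` — hypotheses as in ✓ `CentreSeq.exists_forall_descTransformOK_comap` (A Noetherian domain,
  `K = Frac A` of characteristic `0`, `q : X → Spec A` of finite type with generic square, `s : CentreSeq X`, running ideal `𝓣` with `V(j_K^*𝓣)` INTEGRAL and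
  GEN, K-side `DescCentresSmoothOver` ∧ `DescTransformOK`); conclusion: `∃ a ≠ 0, ∀` Noetherian flat `B ∋ a⁻¹`, `∀` cartesian `X_B` with `B`-flat exceptionals,
  `∀` field point and fibre square `X_k`, `∀ (σ_k : X_k → P_k) (Y₀ : Set P_k)` satisfying INV («every point of `supp j^*ι_B^*𝓣` over a generic point of `Y₀`
  is generic»): `DescTransformOK ((s.comap ι_B).comap j) σ_k Y₀ (supp (j^* ι_B^* 𝓣))` — ALL tokens genuine.  For the door (`σ_k = 𝟙`, `Y₀ = supp j^*ι_B^*𝓣 =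
  range ι`) INV is the tautology ✓ `inv_of_eq`.

HONEST RESIDUAL of `hspread` after this file: ONLY the instantiation/assembly (R2) — `X = ℙⁿ_A` over `A = ℤ[c]/𝔮`, `𝓣 = 𝓗_A` the universal degree-`d`
hypersurface (✓ `LargeChar.univHyp`), the generic square and `X_B = ℙⁿ_B` (✓ `ProjBaseChangeRing.isPullback_projMap'`), the K-side word ✓
`LargeChar.exists_centreSeq_descTransformOK` (…NatLargeCharStrongHypSelf: `σ = 𝟙`, `Y₀ = V(I)`; `H_K` integral ⇒ GEN by ✓ `gen_of_eq`) transported to the model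
(✓ `CentreSeq.exists_comap_eq_of_isPullback_generic`), the smooth base `B = A[1/(a a₀)]` (✓ `LargeChar.exists_formallySmooth_away_of_charZero`; `Spec B` regular ⇒
✓ `CentreSeq.exceptionalFlatOver_of_descCentresSmoothOver` supplies the `B`-flat exceptionals, ✓ `descDoorAt_of_smoothCentres`, ✓ `descDoorAt_of_ringHom`), the
N:=1 glue `DescDoorAt ⇒ DescDoorSharp` (lh2), and (c3) the tying `Cut` («`range ι = fibre of V(𝓗_A)`»).  Size M, bookkeeping only.  EL♮(3) NOT proved; EL♮ NOT
proved; resolution of singularities in positive characteristic NOT proved; nothing of [Hironaka2017] (a candidate under adjudication) is asserted or used.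
[OURS · EGA IV₃ §8–9 recursion over tree lemmas · standard axioms · DEF-FREE · `--supports stmt-ResolutionOfSingularities-20148 --as helper`, counted 0 ·
AI-written, weaker than expert review.] [cite: Grothendieck1966, EGA IV₃ §8–§9, Thm. 9.5.1] [cite: GortzWedhorn2020, (13.19), Prop. 13.91 (3)] (method; index only)
-/

set_option linter.dupNamespace false -- mandated namespace `Summit.<Summit>.<Problem>` of this single-conjunct summit

noncomputable section

open CategoryTheory CategoryTheory.Limits AlgebraicGeometry TopologicalSpace Topology PrimeSpectrum
open Literature.AlgebraicGeometry.Resolution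
open AlgebraicGeometry.Scheme.IdealSheafData

namespace Summit.ResolutionOfSingularities.ResolutionOfSingularities.Cruxes.EquisingularLiftNat.Sections

section FibreWord

variable {A : Type} [CommRing A] [IsDomain A] [IsNoetherianRing A] (K : Type) [Field K] [CharZero K] [Algebra A K] [IsFractionRing A K]

/-- ★★★ **(B5)+(f3) THE FULL FIBRE WORD** — see the module docstring: ✓ `CentreSeq.exists_forall_descTransformOK_comap` with the position token made
GENUINE by threading INV (✓ `inv_closure_preimage_diff_of_isBlowup`) and spreading its input «no swallowing» by Chevalley (✓ `exists_forall_not_support_comap_subset`).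
[cite: Grothendieck1966, EGA IV₃ §8–§9, Thm. 9.5.1] [cite: GortzWedhorn2020, (13.19)] [OURS · L1 W4.5b · RUNG LC (B5)+(f3); EL♮(3) NOT proved] -/
theorem CentreSeq.exists_forall_descTransformOK_comap_of_inv :
    ∀ {X XK : Scheme.{0}} [IsLocallyNoetherian XK] (s : CentreSeq X) (q : X ⟶ Spec (.of A))
      [LocallyOfFiniteType q] [QuasiCompact q] (jK : XK ⟶ X) (qK : XK ⟶ Spec (.of K)) [LocallyOfFiniteType qK],
      IsPullback jK qK q (specOfAlgebra A K) → ∀ (T : X.IdealSheafData) {PK : Scheme.{0}} (σK : XK ⟶ PK) (Y₀K : Set PK),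
      DescCentresSmoothOver (s.comap jK) qK →
      DescTransformOK (s.comap jK) σK Y₀K (((T.comap jK).support : Set XK)) →
      IsIntegral (T.comap jK).subscheme →
      (∀ y, IsGenericPoint y (((T.comap jK).support : Set XK)) → IsGenericPoint (σK y) Y₀K) →
      ∃ a : A, a ≠ 0 ∧ ∀ (B : Type) [CommRing B] [IsNoetherianRing B] [Algebra A B] [Module.Flat A B], IsUnit (algebraMap A B a) →
        ∀ {XB : Scheme.{0}} (ιB : XB ⟶ X) (qB : XB ⟶ Spec (.of B)), IsPullback ιB qB q (specOfAlgebra A B) →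
          (s.comap ιB).ExceptionalFlatOver qB →
          ∀ (k : Type) [Field k] [Algebra B k] {Xk : Scheme.{0}} (j : Xk ⟶ XB) (tk : Xk ⟶ Spec (.of k)),
            IsPullback j tk qB (specOfAlgebra B k) →
            ∀ {Pk : Scheme.{0}} (σk : Xk ⟶ Pk) (Y₀ : Set Pk),
              (∀ y ∈ ((((T.comap ιB).comap j).support : Set Xk)), IsGenericPoint (σk y) Y₀ →
                IsGenericPoint y ((((T.comap ιB).comap j).support : Set Xk))) →
              DescTransformOK ((s.comap ιB).comap j) σk Y₀ ((((T.comap ιB).comap j).support : Set Xk))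
  | X, XK, _, .nil _, q, _, _, jK, qK, _, HK, T, PK, σK, Y₀K, _, hT, hint, _ => by
    haveI : IsLocallyNoetherian X := LocallyOfFiniteType.isLocallyNoetherian q
    haveI := hint
    haveI : PerfectField K := PerfectField.ofCharZero
    -- the K-side END token is the regularity of `V(j_K^*𝓣)` itself (integral ⇒ reduced)
    rw [CentreSeq.comap_nil] at hT
    have hT' : Scheme.IsRegular (vanishingIdeal (⟨closure (((T.comap jK).support : Set XK)), isClosed_closure⟩ : Closeds XK)).subscheme := hT
    have hcl : (⟨closure (((T.comap jK).support : Set XK)), isClosed_closure⟩ : Closeds XK) = (T.comap jK).support :=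
      Closeds.ext (T.comap jK).support.isClosed.closure_eq
    rw [hcl, eq_vanishingIdeal_support_of_isReduced_subscheme (T.comap jK)] at hT'
    -- hence smooth over `K`, and smoothness spreads
    have hsmK : Smooth ((T.comap jK).subschemeι ≫ qK) := smooth_of_isRegular_of_perfectField _ hT'
    obtain ⟨a, ha, h₁⟩ := exists_forall_mem_smoothLocus_of_smooth_comap K q HK T hsmK
    refine ⟨a, ha, fun B _ _ _ _ hunit XB ιB qB HX _ k _ _ Xk j tk HXk Pk σk Y₀ _ => ?_⟩
    haveI : Smooth ((T.comap ιB).subschemeι ≫ qB) := smooth_subschemeι_comap_of_forall_mem_smoothLocus q T h₁ B hunit HX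
    rw [CentreSeq.comap_nil, CentreSeq.comap_nil]
    exact descTransformOK_nil_of_smooth k qB HXk (T.comap ιB) σk Y₀ _ rfl
  | X, XK, _, .cons C rest, q, _, _, jK, qK, _, HK, T, PK, σK, Y₀K, hsm, hT, hint, hGEN => by
    classical
    haveI : IsLocallyNoetherian X := LocallyOfFiniteType.isLocallyNoetherian q
    haveI := hint
    haveI : Flat jK := flat_of_isPullback_generic K q HK
    haveI : IsProper (blowup.π C) := (blowup.isBlowup C).isProper
    haveI : IsLocallyNoetherian (blowup C) := LocallyOfFiniteType.isLocallyNoetherian (blowup.π C)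
    haveI : IsProper (blowup.π (C.comap jK)) := (blowup.isBlowup (C.comap jK)).isProper
    haveI : IsLocallyNoetherian (blowup (C.comap jK)) := LocallyOfFiniteType.isLocallyNoetherian (blowup.π (C.comap jK))
    -- the generic fibre of the blown-up stage
    set g : blowup (C.comap jK) ⟶ blowup C := blowup.comapMap C jK with hg
    haveI : Flat g := blowup.comapMap_mem @Flat C jK inferInstance
    have hsqK : g ≫ blowup.π C = blowup.π (C.comap jK) ≫ jK := blowup.comapMap_π C jK
    have HK₁ : IsPullback g (blowup.π (C.comap jK) ≫ qK) (blowup.π C ≫ q) (specOfAlgebra A K) :=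
      (blowup.isPullback_comapMap C jK).paste_vert HK
    haveI : LocallyOfFiniteType (blowup.π C ≫ q) := inferInstance
    haveI : QuasiCompact (blowup.π C ≫ q) := inferInstance
    haveI : LocallyOfFiniteType (blowup.π (C.comap jK) ≫ qK) := inferInstance
    -- the next running ideal and its generic fibre
    set T' : (blowup C).IdealSheafData := strictTransformIdeal (blowup.π C) C T with hT'def
    have hT'K : T'.comap g = strictTransformIdeal (blowup.π (C.comap jK)) (C.comap jK) (T.comap jK) :=
      comap_strictTransformIdeal_of_flat jK hsqK C T
    have hYK' : (((T'.comap g).support : Set (blowup (C.comap jK)))) =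
        closure (blowup.π (C.comap jK) ⁻¹' ((((T.comap jK).support : Set XK)) \ ((C.comap jK).support : Set XK))) := by
      rw [hT'K]; exact support_strictTransformIdeal_eq_closure _ _ _
    -- the K-side data at this stage
    rw [CentreSeq.comap_cons] at hsm hT
    haveI : Smooth ((C.comap jK).subschemeι ≫ qK) := hsm.1
    obtain ⟨hE1K, hposK, hrestK⟩ := hT
    have hYirr : IsIrreducible (((T.comap jK).support : Set XK)) := isIrreducible_support_of_isIntegral (T.comap jK)
    have hleK : T.comap jK ≤ C.comap jK := le_of_support_subset_of_smooth (T.comap jK) (C.comap jK) qK hE1K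
    have hns : ¬ (((T.comap jK).support : Set XK)) ⊆ (C.comap jK).support :=
      not_subset_support_of_gen σK Y₀K _ (C.comap jK) hYirr (T.comap jK).support.isClosed hGEN hposK
    have hint' : IsIntegral (T'.comap g).subscheme := by
      rw [hT'K]
      exact isIntegral_subscheme_strictTransformIdeal (blowup.isBlowup (C.comap jK)) (T.comap jK) hns
    have hGEN' : ∀ y, IsGenericPoint y (((T'.comap g).support : Set (blowup (C.comap jK)))) →
        IsGenericPoint ((blowup.π (C.comap jK) ≫ σK) y) Y₀K := by
      rw [hYK']
      exact gen_closure_preimage_diff_of_isBlowup hYirr (T.comap jK).support.isClosed (C.comap jK) (blowup.isBlowup (C.comap jK)) hGEN hns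
    have hrestK' : DescTransformOK (rest.comap g) (blowup.π (C.comap jK) ≫ σK) Y₀K (((T'.comap g).support : Set _)) := by
      rw [hYK']; exact hrestK
    -- (2) spread `𝓣 ≤ C`; (3) spread the flatness of the trace `E ∩ V(𝓣')`; (4) the tail
    obtain ⟨a₂, ha₂, h₂⟩ := exists_forall_comap_le_comap K q HK T C hleK
    obtain ⟨a₃, ha₃, h₃⟩ := exists_forall_flat_trace_comap (blowup.π C ≫ q) T' (C.comap (blowup.π C))
    obtain ⟨a₄, ha₄, h₄⟩ := CentreSeq.exists_forall_descTransformOK_comap_of_inv rest (blowup.π C ≫ q) g (blowup.π (C.comap jK) ≫ qK) HK₁ T'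
      (blowup.π (C.comap jK) ≫ σK) Y₀K hsm.2 hrestK' hint' hGEN'
    obtain ⟨a₅, ha₅, h₅⟩ := exists_forall_not_support_comap_subset K q HK T C hns
    refine ⟨a₂ * a₃ * a₄ * a₅, mul_ne_zero (mul_ne_zero (mul_ne_zero ha₂ ha₃) ha₄) ha₅,
      fun B _ _ _ _ hunit XB ιB qB HX hEF k _ _ Xk j tk HXk Pk σk Y₀ hINV => ?_⟩
    rw [map_mul, map_mul, map_mul] at hunit
    have hu₂ : IsUnit (algebraMap A B a₂) :=
      isUnit_of_mul_isUnit_left (isUnit_of_mul_isUnit_left (isUnit_of_mul_isUnit_left hunit))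
    have hu₃ : IsUnit (algebraMap A B a₃) :=
      isUnit_of_mul_isUnit_right (isUnit_of_mul_isUnit_left (isUnit_of_mul_isUnit_left hunit))
    have hu₄ : IsUnit (algebraMap A B a₄) := isUnit_of_mul_isUnit_right (isUnit_of_mul_isUnit_left hunit)
    have hu₅ : IsUnit (algebraMap A B a₅) := isUnit_of_mul_isUnit_right hunit
    -- the B-side stage: flat `ι_B`, locally Noetherian `X_B`, the blown-up square
    haveI : Flat (specOfAlgebra A B) := by
      rw [Flat.SpecMap_iff, CommRingCat.hom_ofHom]
      exact RingHom.flat_algebraMap_iff.mpr inferInstance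
    haveI : Flat ιB := MorphismProperty.of_isPullback HX.flip ‹Flat (specOfAlgebra A B)›
    haveI : LocallyOfFiniteType qB := MorphismProperty.of_isPullback HX (inferInstance : LocallyOfFiniteType q)
    haveI : IsLocallyNoetherian XB := LocallyOfFiniteType.isLocallyNoetherian qB
    haveI : IsProper (blowup.π (C.comap ιB)) := (blowup.isBlowup (C.comap ιB)).isProper
    haveI : IsLocallyNoetherian (blowup (C.comap ιB)) := LocallyOfFiniteType.isLocallyNoetherian (blowup.π (C.comap ιB))
    set ιB' : blowup (C.comap ιB) ⟶ blowup C := blowup.comapMap C ιB with hιB'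
    haveI : Flat ιB' := blowup.comapMap_mem @Flat C ιB inferInstance
    have hsqB : ιB' ≫ blowup.π C = blowup.π (C.comap ιB) ≫ ιB := blowup.comapMap_π C ιB
    have H1 : IsPullback ιB' (blowup.π (C.comap ιB) ≫ qB) (blowup.π C ≫ q) (specOfAlgebra A B) :=
      (blowup.isPullback_comapMap C ιB).paste_vert HX
    -- the fibre stage: locally Noetherian, and the blown-up fibre square (B-flat exceptional divisor)
    haveI : LocallyOfFiniteType tk := MorphismProperty.of_isPullback HXk (inferInstance : LocallyOfFiniteType qB)
    haveI : IsLocallyNoetherian Xk := LocallyOfFiniteType.isLocallyNoetherian tk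
    haveI : IsProper (blowup.π ((C.comap ιB).comap j)) := (blowup.isBlowup _).isProper
    haveI : IsLocallyNoetherian (blowup ((C.comap ιB).comap j)) := LocallyOfFiniteType.isLocallyNoetherian (blowup.π ((C.comap ιB).comap j))
    rw [CentreSeq.comap_cons] at hEF
    haveI : Flat ((((C.comap ιB).comap (blowup.π (C.comap ιB)))).subschemeι ≫ blowup.π (C.comap ιB) ≫ qB) := hEF.1
    set j' : blowup ((C.comap ιB).comap j) ⟶ blowup (C.comap ιB) := blowup.comapMap (C.comap ιB) j with hj'
    have hsqk : j' ≫ blowup.π (C.comap ιB) = blowup.π ((C.comap ιB).comap j) ≫ j := blowup.comapMap_π _ _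
    have HXk₁ : IsPullback j' (blowup.π ((C.comap ιB).comap j) ≫ tk) (blowup.π (C.comap ιB) ≫ qB) (specOfAlgebra B k) :=
      blowup.isPullback_comapMap_specMap_of_flat_exceptional k qB (C.comap ιB) HXk
    -- the B-side running ideals: `𝓣' · 𝒪 = strictTransformIdeal π_B C_B 𝓣_B` (flat base change) and the trace is flat
    have e2 : T'.comap ιB' = strictTransformIdeal (blowup.π (C.comap ιB)) (C.comap ιB) (T.comap ιB) :=
      comap_strictTransformIdeal_of_flat ιB hsqB C T
    have e1 : (C.comap (blowup.π C)).comap ιB' = (C.comap ιB).comap (blowup.π (C.comap ιB)) :=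
      (comap_exceptional_eq_comap_comapMap C ιB).symm
    have hflat := h₃ B hu₃ ιB' (blowup.π (C.comap ιB) ≫ qB) H1
    rw [e1, e2] at hflat
    haveI := hflat
    -- the k-side running sets: the tail's is the fibre of the B-side strict transform (LC-FIB)
    have hsuppeq : ((((T'.comap ιB').comap j').support : Set (blowup ((C.comap ιB).comap j)))) =
        closure (blowup.π ((C.comap ιB).comap j) ⁻¹'
          (((((T.comap ιB).comap j).support : Set Xk)) \ ((((C.comap ιB).comap j).support : Set Xk)))) := by
      rw [e2]
      exact support_comap_strictTransformIdeal_of_flat_trace k j hsqk (blowup.π (C.comap ιB) ≫ qB) HXk₁ (C.comap ιB) (T.comap ιB)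
        (blowup.isBlowup (C.comap ιB)).isEffectiveCartier
    -- the tokens at this stage
    have hE1 : ((((C.comap ιB).comap j).support : Set Xk)) ⊆ (((T.comap ιB).comap j).support : Set Xk) :=
      descTransformOK_E1_of_le j (h₂ B hu₂ ιB qB HX) _ rfl
    have hnsk : ¬ ((((T.comap ιB).comap j).support : Set Xk)) ⊆ (((C.comap ιB).comap j).support : Set Xk) :=
      h₅ B hu₅ ιB qB HX k j tk HXk
    have hpos := image_support_subset_not_isGenericPoint_of_inv σk Y₀ _ ((C.comap ιB).comap j) hINV hE1 hnsk
    -- INV for the next fibre stage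
    have hINV' := inv_closure_preimage_diff_of_isBlowup ((T.comap ιB).comap j).support.isClosed ((C.comap ιB).comap j)
      (blowup.isBlowup ((C.comap ιB).comap j)) hINV hnsk
    rw [← hsuppeq] at hINV'
    -- the goal, clause by clause
    rw [CentreSeq.comap_cons, CentreSeq.comap_cons]
    refine ⟨hE1, hpos, ?_⟩
    have key := h₄ B hu₄ ιB' (blowup.π (C.comap ιB) ≫ qB) H1 hEF.2 k j' (blowup.π ((C.comap ιB).comap j) ≫ tk) HXk₁
      (blowup.π ((C.comap ιB).comap j) ≫ σk) Y₀ hINV'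
    rw [hsuppeq] at key
    exact key

end FibreWord

end Summit.ResolutionOfSingularities.ResolutionOfSingularities.Cruxes.EquisingularLiftNat.Sections

end
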